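import Summits.AtomisticToContinuum.BoseEinsteinCondensation.Theorems.BECRewardDescentRewardChordBoundSlotAverage
import Literature.MathematicalPhysics.QuantumManyBody.PeriodicHardCoreCutoffState
import HarnessLib
-- module: Summits.AtomisticToContinuum.BoseEinsteinCondensation.Theorems.BECRewardDescentRewardChordBoundHeredityHelpers

/-!
# The heredity transform, helper file (crux `RewardChordBound`, stmt-AtomisticToContinuum-12876,
# stub R2 `stub_teleportPackage`, registered sub-goal `stub_teleportPackage_Heredity`)

Setting: `N` bosons on the torus `(ℝ/ℤ)^{N×3}` (Haar probability measure, the convention of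
`PeriodicFormDomain.lean`), maximal form `maxForm v L = maxFormKin L + maxFormPot v L` of a measurable pair
profile `v` (hard cores allowed), slot averages `Pᵢη = η - exciteProj N i η` (`= ∫ η(· + σᵢ c) dc` a.e., helper
file `…SlotAverage`). The lead's **heredity transform** of a non-negative Bose-symmetric class `η` of finite
maximal form is `Θ = ∑ᵢ gᵢ · Pᵢη` with the star cut-offs `gᵢ = ∏_{j ≠ i} θ((ρᵢⱼ - R₀/L)/δ)` (particle `i`
farther than `R₀/L + δ` from all others). This file proves the four abstract ingredients of its admissibility:

* `mem_boseSymmetric_of_coeFn_eq_sum` — `∑ᵢ wᵢ · Pᵢη` is Bose-symmetric whenever `η` is and the real weights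
  relabel, `wᵢ(t ∘ (σ × id)) = w_{σ i}(t)` (pointwise a.e. symmetry through `measurePreserving_compPerm`, the slot
  averages relabel by the pull-back of the a.e. invariance of `η` through the shear `(t, c) ↦ t + σᵢ c`);
* `absLp_eq_of_coeFn_eq_sum` — it is non-negative for non-negative weights and `|η| = η`;
* `maxFormKin_ne_top_of_coeFn_eq_mul` — `maxFormKin L [χ A] < ∞` for `maxFormKin L A < ∞` and a continuous
  multiplier `|χ| ≤ 1` with a uniform Lipschitz constant along the coordinate lines (the Leibniz estimate
  `Torus.tsum_sq_mul_enorm_mFourierCoeff_mul_le` with a constant modulus, direction by direction);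
* `maxFormPot_le_of_coeFn_eq_mul_sub_exciteProj` — `maxFormPot v L [χ Pᵢη] ≤ maxFormPot v L η` when `v = 0`
  beyond `R₀` and `χ ≠ 0` forces particle `i` to be `R₀/L`-free: there the interaction does not see particle `i`,
  so it does not decrease under the one-slot shifts of `i` (`periodicInteraction_le_of_free`), and Jensen for the
  slot average plus `∫∫ f(t + σᵢ c) = ∫ f` conclude;
together with `maxFormKin_sub_exciteProj_le`, `maxForm_sum_ne_top` and `coeFn_finset_sum`.

References: M. Reed, B. Simon, *Methods of Modern Mathematical Physics IV* (1978), §XIII.12 [ReedSimonIV1978];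
D. Gilbarg, N. S. Trudinger, *Elliptic PDE of Second Order* (2001), eq. (7.18) [GilbargTrudinger2001].
-/

noncomputable section

open MeasureTheory Filter Set Complex UnitAddTorus
open scoped ENNReal NNReal Topology InnerProductSpace ComplexConjugate
open Literature.Analysis.FunctionSpaces Literature.Analysis.OperatorTheory Literature.Analysis.InnerProduct

namespace Summit.AtomisticToContinuum.BoseEinsteinCondensation.Cruxes.RewardChordBound.Birth.Heredity

open Literature.MathematicalPhysics.QuantumManyBody.BoseGas
open Summit.AtomisticToContinuum.BoseEinsteinCondensation.Cruxes.RewardChordBound.Birth.SlotAverage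

-- The measure on `ℝ/ℤ` is the Haar PROBABILITY measure, as in `PeriodicFormDomain.lean`.
attribute [local instance] Literature.MathematicalPhysics.QuantumManyBody.BoseGas.formDomain_measureSpace
  Literature.MathematicalPhysics.QuantumManyBody.BoseGas.formDomain_isProbabilityMeasure
  Literature.MathematicalPhysics.QuantumManyBody.BoseGas.formDomain_isProbabilityMeasure_pi

variable {N : ℕ} {L : ℝ} {v : ℝ → ℝ≥0∞}

/-- Local notation for the Hilbert space `L²((ℝ/ℤ)^{3N})`, as in `PeriodicFormDomain.lean`. -/
local notation "L2T " N':max => Lp ℂ 2 (volume : Measure (UnitAddTorus (Fin N' × Fin 3)))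

/-- Local notation for the configuration torus `(ℝ/ℤ)^{N×3}`. -/
local notation "TN " N':max => UnitAddTorus (Fin N' × Fin 3)

/-- Local notation for the one-particle torus `(ℝ/ℤ)³`. -/
local notation "T3" => UnitAddTorus (Fin 3)

-- Translation invariance of the Haar product measure (closed local-instance defs of the tree).
attribute [local instance] Literature.MathematicalPhysics.QuantumManyBody.BoseGas.slotShift_isAddRightInvariant

/-! ### `L²` bookkeeping -/

/-- The representative of a finite sum of `L²` classes is a.e. the sum of the representatives. [folklore] -/
theorem coeFn_finset_sum {ι : Type*} (s : Finset ι) (f : ι → L2T N) :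
    ((∑ i ∈ s, f i : L2T N) : TN N → ℂ) =ᵐ[volume] fun t => ∑ i ∈ s, (f i : TN N → ℂ) t := by
  classical
  -- adapted from Literature/Geometry/Lorentzian/KerrCarterFrequencyIdentity.lean (`coeFn_sum_smul`)
  induction s using Finset.induction_on with
  | empty =>
    rw [Finset.sum_empty]
    filter_upwards [Lp.coeFn_zero ℂ 2 (volume : Measure (TN N))] with t ht
    rw [ht, Finset.sum_empty]
    rfl
  | insert a s ha ih =>
    rw [Finset.sum_insert ha]
    filter_upwards [Lp.coeFn_add (f a) (∑ i ∈ s, f i), ih] with t h1 h2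
    rw [h1, Pi.add_apply, h2, Finset.sum_insert ha]

/-- `χ A ∈ L²` for a continuous real multiplier with `|χ| ≤ 1`. [folklore] -/
theorem memLp_ofReal_mul_of_abs_le_one {χ : TN N → ℝ} (hχc : Continuous χ) (hχb : ∀ t, |χ t| ≤ 1) (A : L2T N) :
    MemLp (fun t => (χ t : ℂ) * (A : TN N → ℂ) t) 2 (volume : Measure (TN N)) :=
  (Lp.memLp A).of_le_mul (c := 1) ((Complex.continuous_ofReal.comp hχc).aestronglyMeasurable.mul (Lp.memLp A).1)
    (Eventually.of_forall fun t => by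
      rw [norm_mul, Complex.norm_real, Real.norm_eq_abs]
      exact mul_le_mul_of_nonneg_right (hχb t) (norm_nonneg _))

/-- The maximal form of a sum is finite if both summands have finite maximal form. [folklore] -/
theorem maxForm_add_ne_top (hv : Measurable v) {x y : L2T N} (hx : maxForm v L x ≠ ⊤) (hy : maxForm v L y ≠ ⊤) :
    maxForm v L (x + y) ≠ ⊤ := by
  rw [maxForm_def] at hx hy ⊢
  obtain ⟨hx1, hx2⟩ := ENNReal.add_ne_top.1 hx
  obtain ⟨hy1, hy2⟩ := ENNReal.add_ne_top.1 hy
  exact ENNReal.add_ne_top.2 ⟨maxFormKin_add_ne_top hx1 hy1, maxFormPot_add_ne_top hv hx2 hy2⟩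

/-- The maximal form of a finite sum is finite if every summand has finite maximal form. [folklore] -/
theorem maxForm_sum_ne_top (hv : Measurable v) {ι : Type*} (s : Finset ι) {f : ι → L2T N}
    (hf : ∀ i ∈ s, maxForm v L (f i) ≠ ⊤) : maxForm v L (∑ i ∈ s, f i) ≠ ⊤ :=
  Finset.sum_induction f (fun x => maxForm v L x ≠ ⊤) (fun _ _ ha hb => maxForm_add_ne_top hv ha hb)
    (by rw [maxForm_zero]; exact ENNReal.zero_ne_top) hf

/-- **The slot average does not increase the kinetic part**: `maxFormKin L (η - exciteProj N i η) ≤ maxFormKin L η`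
(its Fourier coefficients are `𝟙[n(i,·) = 0] η̂(n)`). [folklore] -/
theorem maxFormKin_sub_exciteProj_le (L : ℝ) (i : Fin N) (η : L2T N) :
    maxFormKin L (η - exciteProj N i η) ≤ maxFormKin L η := by
  unfold maxFormKin
  refine ENNReal.tsum_le_tsum fun n => mul_le_mul' le_rfl ?_
  rw [inner_sub_right, inner_mFourierLp_exciteProj]
  split_ifs
  · rw [sub_zero]
  · rw [sub_self, nnnorm_zero, ENNReal.coe_zero, zero_pow two_ne_zero]
    exact zero_le

/-! ### Bose symmetry of `∑ᵢ wᵢ · Pᵢη` -/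

/-- The one-slot shifts relabel under a particle permutation:
`t ∘ (σ × id) + σᵢ c = (t + σ_{σ i} c) ∘ (σ × id)`. [folklore] -/
theorem comp_perm_add_slotShift (σ : Equiv.Perm (Fin N)) (i : Fin N) (t : TN N) (c : T3) :
    (fun q : Fin N × Fin 3 => t (Equiv.prodCongr σ (Equiv.refl (Fin 3)) q)) + slotShift i c =
      fun q : Fin N × Fin 3 => (t + slotShift (σ i) c) (Equiv.prodCongr σ (Equiv.refl (Fin 3)) q) := by
  funext q
  rcases q with ⟨a, k⟩
  by_cases ha : a = i
  · subst ha
    simp only [Pi.add_apply, Equiv.prodCongr_apply, Prod.map_apply, Equiv.coe_refl, id_eq, slotShift_apply_same]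
  · have hσ : σ a ≠ σ i := fun h => ha (σ.injective h)
    simp only [Pi.add_apply, Equiv.prodCongr_apply, Prod.map_apply, Equiv.coe_refl, id_eq,
      slotShift_apply_of_ne ha, slotShift_apply_of_ne hσ]

/-- **The slot averages relabel**: for Bose-symmetric `η`, a permutation `σ` and a slot `i`,
`∫ η(t ∘ (σ × id) + σᵢ c) dc = ∫ η(t + σ_{σ i} c) dc` for a.e. `t` (pull the a.e. invariance of `η` back through
the shear `(t, c) ↦ t + σ_{σ i} c`). [folklore] -/
theorem slotAvg_comp_perm_ae {η : L2T N} (hη : η ∈ boseSymmetric N) (σ : Equiv.Perm (Fin N)) (i : Fin N) :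
    ∀ᵐ t : TN N, (∫ c : T3, (η : TN N → ℂ)
        ((fun q : Fin N × Fin 3 => t (Equiv.prodCongr σ (Equiv.refl (Fin 3)) q)) + slotShift i c)) =
      ∫ c : T3, (η : TN N → ℂ) (t + slotShift (σ i) c) := by
  set τ : Equiv.Perm (Fin N × Fin 3) := Equiv.prodCongr σ (Equiv.refl (Fin 3)) with hτ
  have hτn : ∀ m : Fin N × Fin 3 → ℤ, (fun q => m (τ q)) = fun p : Fin N × Fin 3 => m (σ p.1, p.2) :=
    fun m => comp_prodCongr_eq σ m
  have hηm : Measurable (η : TN N → ℂ) := (Lp.stronglyMeasurable η).measurable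
  -- a.e. invariance of `η` under the relabelling
  have hηae : ∀ᵐ u : TN N, (η : TN N → ℂ) (fun q => u (τ q)) = (η : TN N → ℂ) u :=
    ae_eq_comp_perm_of_inner_symm η τ fun m => by rw [hτn]; exact hη σ m
  have hP : MeasurableSet {u : TN N | (η : TN N → ℂ) (fun q => u (τ q)) = (η : TN N → ℂ) u} :=
    measurableSet_eq_fun (hηm.comp (measurable_pi_lambda _ fun q => measurable_pi_apply (τ q))) hηm
  -- pulled back through the shear of slot `σ i`
  have h2 := ae_prod_comp_add_slotShift (σ i) (P := fun u => (η : TN N → ℂ) (fun q => u (τ q)) = (η : TN N → ℂ) u)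
    hP hηae
  rw [Measure.volume_eq_prod] at h2
  filter_upwards [Measure.ae_ae_of_ae_prod h2] with t ht
  refine integral_congr_ae ?_
  filter_upwards [ht] with c hc
  rw [← hc, comp_perm_add_slotShift σ i t c]

/-- **`∑ᵢ wᵢ · Pᵢη` is Bose-symmetric** for Bose-symmetric `η` and real weights that relabel under the particle
permutations, `wᵢ(t ∘ (σ × id)) = w_{σ i}(t)`: pointwise, `Θ(t ∘ (σ × id)) = ∑ᵢ w_{σi}(t) (P_{σi}η)(t) = Θ(t)` a.e.,
and a.e. invariance is Bose symmetry in momentum space (`inner_symm_of_ae_eq_comp_perm`). [folklore] -/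
theorem mem_boseSymmetric_of_coeFn_eq_sum {w : Fin N → TN N → ℝ}
    (hw : ∀ (σ : Equiv.Perm (Fin N)) (i : Fin N) (t : TN N),
      w i (fun q : Fin N × Fin 3 => t (Equiv.prodCongr σ (Equiv.refl (Fin 3)) q)) = w (σ i) t)
    {η Θ : L2T N} (hη : η ∈ boseSymmetric N)
    (hΘ : (Θ : TN N → ℂ) =ᵐ[volume] fun t => ∑ i : Fin N, (w i t : ℂ) * ((η - exciteProj N i η : L2T N) : TN N → ℂ) t) :
    Θ ∈ boseSymmetric N := by
  intro σ n
  set τ : Equiv.Perm (Fin N × Fin 3) := Equiv.prodCongr σ (Equiv.refl (Fin 3)) with hτ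
  have hτn : (fun q => n (τ q)) = fun p : Fin N × Fin 3 => n (σ p.1, p.2) := comp_prodCongr_eq σ n
  -- the representative of `Θ` through the slot averages
  have hrep : ∀ᵐ t : TN N, (Θ : TN N → ℂ) t =
      ∑ i : Fin N, (w i t : ℂ) * ∫ c : T3, (η : TN N → ℂ) (t + slotShift i c) := by
    have hA := ae_all_iff.2 fun i : Fin N => coeFn_sub_exciteProj_ae_eq_slotAvg i η
    filter_upwards [hΘ, hA] with t ht hAt
    rw [ht]
    exact Finset.sum_congr rfl fun i _ => by rw [hAt i]
  -- transported through the measure-preserving relabelling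
  have hrepT : ∀ᵐ t : TN N, (Θ : TN N → ℂ) (fun q => t (τ q)) =
      ∑ i : Fin N, (w i (fun q => t (τ q)) : ℂ) * ∫ c : T3, (η : TN N → ℂ) ((fun q => t (τ q)) + slotShift i c) := by
    have h := (measurePreserving_compPerm (D := Fin N × Fin 3) τ).quasiMeasurePreserving.ae_eq_comp hrep
    filter_upwards [h] with t ht
    simpa only [Function.comp_apply, compPerm_apply] using ht
  -- pointwise a.e. symmetry
  have hΘae : ∀ᵐ t : TN N, (Θ : TN N → ℂ) (fun q => t (τ q)) = (Θ : TN N → ℂ) t := by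
    filter_upwards [hrep, hrepT, ae_all_iff.2 fun i : Fin N => slotAvg_comp_perm_ae hη σ i] with t h1 h2 h3
    rw [h2, h1]
    calc ∑ i : Fin N, (w i (fun q => t (τ q)) : ℂ) * ∫ c : T3, (η : TN N → ℂ) ((fun q => t (τ q)) + slotShift i c)
        = ∑ i : Fin N, (w (σ i) t : ℂ) * ∫ c : T3, (η : TN N → ℂ) (t + slotShift (σ i) c) :=
          Finset.sum_congr rfl fun i _ => by rw [h3 i, hw σ i t]
      _ = ∑ i : Fin N, (w i t : ℂ) * ∫ c : T3, (η : TN N → ℂ) (t + slotShift i c) :=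
          Equiv.sum_comp σ (fun i => (w i t : ℂ) * ∫ c : T3, (η : TN N → ℂ) (t + slotShift i c))
  rw [← hτn]
  exact inner_symm_of_ae_eq_comp_perm Θ τ hΘae n

/-! ### Non-negativity of `∑ᵢ wᵢ · Pᵢη` -/

/-- **`∑ᵢ wᵢ · Pᵢη ≥ 0`** for non-negative weights and a non-negative class `|η| = η` (the slot averages of a
non-negative class are real non-negative a.e.). [folklore] -/
theorem absLp_eq_of_coeFn_eq_sum {w : Fin N → TN N → ℝ} (hw0 : ∀ i t, 0 ≤ w i t) {η Θ : L2T N}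
    (hη : absLp η = η)
    (hΘ : (Θ : TN N → ℂ) =ᵐ[volume] fun t => ∑ i : Fin N, (w i t : ℂ) * ((η - exciteProj N i η : L2T N) : TN N → ℂ) t) :
    absLp Θ = Θ := by
  refine Lp.ext ?_
  have hA := ae_all_iff.2 fun i : Fin N => coeFn_sub_exciteProj_ae_eq_slotAvg i η
  have hnn := ae_all_iff.2 fun i : Fin N => slotAvg_eq_ofReal_of_absLp_eq i hη
  filter_upwards [coeFn_absLp Θ, hΘ, hA, hnn] with t h1 h2 h3 h4
  rw [h1, h2]
  have hreal : ∑ i : Fin N, (w i t : ℂ) * ((η - exciteProj N i η : L2T N) : TN N → ℂ) t =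
      ((∑ i : Fin N, w i t * ∫ c : T3, ‖(η : TN N → ℂ) (t + slotShift i c)‖ : ℝ) : ℂ) := by
    rw [Complex.ofReal_sum]
    exact Finset.sum_congr rfl fun i _ => by rw [h3 i, h4 i, Complex.ofReal_mul]
  rw [hreal, Complex.norm_real, Real.norm_eq_abs, abs_of_nonneg]
  exact Finset.sum_nonneg fun i _ => mul_nonneg (hw0 i t) (integral_nonneg fun c => norm_nonneg _)

/-! ### The kinetic part of `χ A` -/

/-- **Finite kinetic energy survives a bounded, coordinate-Lipschitz multiplier.** For `0 < L`, a continuous real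
`χ` with `|χ| ≤ 1` and `|χ(t + s𝐞_p) - χ(t)| ≤ C|s|` for all directions `p`, and classes `A`, `F` with
`maxFormKin L A < ∞` and `F = χ A` a.e.: `maxFormKin L F < ∞` (the Leibniz estimate
`Torus.tsum_sq_mul_enorm_mFourierCoeff_mul_le` with the constant modulus `C`, direction by direction).
[cite: GilbargTrudinger2001, eq. (7.18)] -/
theorem maxFormKin_ne_top_of_coeFn_eq_mul (hL : 0 < L) {χ : TN N → ℝ} (hχc : Continuous χ) (hχb : ∀ t, |χ t| ≤ 1)
    {C : ℝ} (hχL : ∀ (p : Fin N × Fin 3) (t : TN N) (s : ℝ),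
      |χ (t + Pi.single p ((s : ℝ) : UnitAddCircle)) - χ t| ≤ C * |s|)
    {A F : L2T N} (hA : maxFormKin L A ≠ ⊤)
    (hF : (F : TN N → ℂ) =ᵐ[volume] fun t => (χ t : ℂ) * (A : TN N → ℂ) t) :
    maxFormKin L F ≠ ⊤ := by
  classical
  have hcoef : ∀ n : Fin N × Fin 3 → ℤ, mFourierCoeff (F : TN N → ℂ) n =
      mFourierCoeff (fun t => (χ t : ℂ) * (A : TN N → ℂ) t) n := fun n => mFourierCoeff_congr_ae hF n
  have hB : ∀ t : TN N, ‖(χ t : ℂ)‖ ≤ ((1 : ℝ≥0) : ℝ) := fun t => by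
    rw [NNReal.coe_one, Complex.norm_real, Real.norm_eq_abs]
    exact hχb t
  rw [maxFormKin_eq_sum_coord]
  refine ENNReal.sum_ne_top.2 fun q _ => ENNReal.mul_ne_top ENNReal.ofReal_ne_top ?_
  simp only [hcoef]
  have hΛ : ∀ (x : TN N) (s : ℝ), |s| ≤ 1 →
      ‖((χ (x + Pi.single q ((s : ℝ) : UnitAddCircle)) : ℝ) : ℂ) - (χ x : ℂ)‖ₑ ≤
        ENNReal.ofReal |s| * ENNReal.ofReal C := fun x s _ => by
    rw [← ENNReal.ofReal_mul (abs_nonneg s)]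
    exact Torus.enorm_ofReal_sub_ofReal_le (by rw [mul_comm]; exact hχL q x s)
  have h := Torus.tsum_sq_mul_enorm_mFourierCoeff_mul_le (Complex.continuous_ofReal.comp hχc).aestronglyMeasurable
    hB (memLp_global A) q one_pos hΛ one_pos
  refine ne_top_of_le_ne_top (ENNReal.add_ne_top.2 ⟨?_, ?_⟩) h
  · exact ENNReal.mul_ne_top (ENNReal.mul_ne_top ENNReal.ofReal_ne_top (by simp))
      (tsum_coord_ne_top_of_maxFormKin_ne_top hL hA q)
  · refine ENNReal.mul_ne_top (ENNReal.mul_ne_top ENNReal.ofReal_ne_top ENNReal.ofReal_ne_top) ?_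
    rw [lintegral_const_mul' _ _ (ENNReal.pow_ne_top ENNReal.ofReal_ne_top)]
    exact ENNReal.mul_ne_top (ENNReal.pow_ne_top ENNReal.ofReal_ne_top)
      (Torus.lintegral_enorm_sq_lt_top_of_memLp (memLp_global A)).ne

/-! ### The potential part of `χ · Pᵢη` for a multiplier freeing particle `i` -/

/-- Shifting slot `i` does not move the other particles of the cell representative. [folklore] -/
theorem fromUnitTorusN_add_slotShift_of_ne (L : ℝ) (t : TN N) {i a : Fin N} (h : a ≠ i) (c : T3) :
    fromUnitTorusN L (t + slotShift i c) a = fromUnitTorusN L t a := by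
  rw [fromUnitTorusN_apply, fromUnitTorusN_apply]
  congr 1
  funext k
  rw [Pi.add_apply, slotShift_apply_of_ne h, add_zero]

/-- A pair farther (nearest image) than `R₀/L` does not interact when `v = 0` beyond `R₀` (`0 < L`). [folklore] -/
theorem periodizedPotential_eq_zero_of_lt_pairDist (hL : 0 < L) {R₀ : ℝ} (hv0 : ∀ r, R₀ < r → v r = 0) {t : TN N}
    {a b : Fin N} (h : R₀ / L < Torus.pairDist a b t) :
    periodizedPotential v L (fromUnitTorusN L t a - fromUnitTorusN L t b) = 0 := by
  have hlt : R₀ < L * Torus.pairDist a b t := (div_lt_iff₀' hL).1 h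
  rw [periodizedPotential_eq_of_lt_pairDist (v' := fun _ => 0) (fun ρ hρ => hv0 ρ hρ) hL.le t hlt]
  simp [periodizedPotential]

/-- **A free particle may be moved anywhere without lowering the interaction**: if `v = 0` beyond `R₀`, `0 < L`,
and particle `i` is farther than `R₀/L` from every other particle at `t`, then
`W(fromUnitTorusN L t) ≤ W(fromUnitTorusN L (t + σᵢ c))` for every one-slot shift `c` (the pairs containing `i`
contribute `0` at `t`, the others do not move). [folklore] -/
theorem periodicInteraction_le_of_free (hL : 0 < L) {R₀ : ℝ} (hv0 : ∀ r, R₀ < r → v r = 0) {i : Fin N} {t : TN N}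
    (ht : ∀ j, j ≠ i → R₀ / L < Torus.pairDist i j t) (c : T3) :
    periodicInteraction v L (fromUnitTorusN L t) ≤ periodicInteraction v L (fromUnitTorusN L (t + slotShift i c)) := by
  unfold periodicInteraction
  refine Finset.sum_le_sum fun a _ => Finset.sum_le_sum fun b hb => ?_
  have hab : a < b := (Finset.mem_filter.1 hb).2
  by_cases hai : a = i
  · subst hai
    rw [periodizedPotential_eq_zero_of_lt_pairDist hL hv0 (ht b hab.ne')]
    exact zero_le
  · by_cases hbi : b = i
    · subst hbi
      rw [periodizedPotential_eq_zero_of_lt_pairDist hL hv0 (by rw [Torus.pairDist_comm]; exact ht a hab.ne)]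
      exact zero_le
    · rw [fromUnitTorusN_add_slotShift_of_ne L t hai c, fromUnitTorusN_add_slotShift_of_ne L t hbi c]

/-- **The potential energy of `χ · Pᵢη` for a multiplier freeing particle `i`.** Let `0 < L`, `v` measurable with
`v = 0` beyond `R₀`, `χ` continuous real with `|χ| ≤ 1` and `χ(t) ≠ 0 ⇒ ρᵢⱼ(t) > R₀/L` for all `j ≠ i`, and
`F = χ · (η - exciteProj N i η)` a.e. Then `maxFormPot v L F ≤ maxFormPot v L η`: pointwise a.e.
`W(t)|χ Pᵢη|²(t) ≤ W(t) ∫ |η(t + σᵢc)|² dc ≤ ∫ W(t + σᵢc)|η(t + σᵢc)|² dc` (Jensen, and `W(t) ≤ W(t + σᵢc)` where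
`χ(t) ≠ 0`), and `∫∫ f(t + σᵢ c) = ∫ f`. [folklore] -/
theorem maxFormPot_le_of_coeFn_eq_mul_sub_exciteProj (hL : 0 < L) (hv : Measurable v) {R₀ : ℝ}
    (hv0 : ∀ r, R₀ < r → v r = 0) {i : Fin N} {χ : TN N → ℝ} (hχb : ∀ t, |χ t| ≤ 1)
    (hχfree : ∀ t, χ t ≠ 0 → ∀ j, j ≠ i → R₀ / L < Torus.pairDist i j t) (η : L2T N) {F : L2T N}
    (hF : (F : TN N → ℂ) =ᵐ[volume] fun t => (χ t : ℂ) * ((η - exciteProj N i η : L2T N) : TN N → ℂ) t) :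
    maxFormPot v L F ≤ maxFormPot v L η := by
  have hA := coeFn_sub_exciteProj_ae_eq_slotAvg i η
  have hηm : Measurable (η : TN N → ℂ) := (Lp.stronglyMeasurable η).measurable
  have hf : Measurable fun u : TN N => periodicInteraction v L (fromUnitTorusN L u) * ‖(η : TN N → ℂ) u‖ₑ ^ 2 :=
    (measurable_periodicInteraction_fromUnitTorusN hv L).mul (hηm.enorm.pow_const 2)
  have hf2 : Measurable fun p : TN N × T3 => periodicInteraction v L (fromUnitTorusN L (p.1 + slotShift i p.2)) *
      ‖(η : TN N → ℂ) (p.1 + slotShift i p.2)‖ₑ ^ 2 := hf.comp (measurable_add_slotShift i)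
  unfold maxFormPot
  simp only [← enorm_eq_nnnorm]
  calc ∫⁻ t, periodicInteraction v L (fromUnitTorusN L t) * ‖(F : TN N → ℂ) t‖ₑ ^ 2
      ≤ ∫⁻ t, ∫⁻ c : T3, periodicInteraction v L (fromUnitTorusN L (t + slotShift i c)) *
          ‖(η : TN N → ℂ) (t + slotShift i c)‖ₑ ^ 2 := by
        refine lintegral_mono_ae ?_
        filter_upwards [hF, hA] with t hFt hAt
        rw [hFt]
        by_cases h0 : χ t = 0
        · rw [h0, Complex.ofReal_zero, zero_mul, enorm_zero, zero_pow two_ne_zero, mul_zero]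
          exact zero_le
        · have hmc : Measurable fun c : T3 => ‖(η : TN N → ℂ) (t + slotShift i c)‖ₑ ^ 2 :=
            ((hηm.comp (measurable_const.add (measurable_slotShift i))).enorm.pow_const 2)
          calc periodicInteraction v L (fromUnitTorusN L t) *
                ‖(χ t : ℂ) * ((η - exciteProj N i η : L2T N) : TN N → ℂ) t‖ₑ ^ 2
              ≤ periodicInteraction v L (fromUnitTorusN L t) * ‖((η - exciteProj N i η : L2T N) : TN N → ℂ) t‖ₑ ^ 2 := by
                refine mul_le_mul' le_rfl ?_
                rw [enorm_mul]
                refine pow_le_pow_left' (mul_le_of_le_one_left zero_le ?_) 2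
                rw [← ofReal_norm, Complex.norm_real, Real.norm_eq_abs]
                exact ENNReal.ofReal_le_one.2 (hχb t)
            _ ≤ periodicInteraction v L (fromUnitTorusN L t) * ∫⁻ c : T3, ‖(η : TN N → ℂ) (t + slotShift i c)‖ₑ ^ 2 := by
                rw [hAt]
                exact mul_le_mul' le_rfl (enorm_slotAvg_sq_le i η t)
            _ = ∫⁻ c : T3, periodicInteraction v L (fromUnitTorusN L t) * ‖(η : TN N → ℂ) (t + slotShift i c)‖ₑ ^ 2 :=
                (lintegral_const_mul _ hmc).symm
            _ ≤ ∫⁻ c : T3, periodicInteraction v L (fromUnitTorusN L (t + slotShift i c)) *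
                  ‖(η : TN N → ℂ) (t + slotShift i c)‖ₑ ^ 2 :=
                lintegral_mono fun c => mul_le_mul' (periodicInteraction_le_of_free hL hv0 (hχfree t h0) c) le_rfl
    _ = ∫⁻ p : TN N × T3, periodicInteraction v L (fromUnitTorusN L (p.1 + slotShift i p.2)) *
          ‖(η : TN N → ℂ) (p.1 + slotShift i p.2)‖ₑ ^ 2 := by
        rw [Measure.volume_eq_prod, lintegral_prod _ hf2.aemeasurable]
    _ = ∫⁻ t, periodicInteraction v L (fromUnitTorusN L t) * ‖(η : TN N → ℂ) t‖ₑ ^ 2 :=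
        lintegral_comp_add_slotShift i hf

end Summit.AtomisticToContinuum.BoseEinsteinCondensation.Cruxes.RewardChordBound.Birth.Heredity

namespace Summit.AtomisticToContinuum.BoseEinsteinCondensation.Cruxes.RewardChordBound.Birth

open Summit.AtomisticToContinuum.BoseEinsteinCondensation.Cruxes.RewardChordBound.Birth.Heredity
  Literature.MathematicalPhysics.QuantumManyBody.BoseGas

/-- **Registered sub-goal `stub_teleportPackage_HeredityPotential` of stub `stub_teleportPackage` (helper file of the
heredity transform: the potential energy of a slot average cut off to the free region of its particle).** For `0 < L`,
measurable `v` vanishing beyond `R₀`, a slot `i`, a real multiplier `χ` with `|χ| ≤ 1` whose non-vanishing at `t`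
forces `ρᵢⱼ(t) > R₀/L` for all `j ≠ i`, and classes `η`, `F` with `F = χ · (η - exciteProj N i η)` a.e.:
`maxFormPot v L F ≤ maxFormPot v L η` (`maxFormPot_le_of_coeFn_eq_mul_sub_exciteProj`; the `L²` space is written with
the explicit Haar product measure, definitionally the package's `L2T N`). [cite: ReedSimonIV1978, §XIII.12] -/
theorem stub_teleportPackage_HeredityPotential :
    ∀ (N : ℕ) (L : ℝ) (v : ℝ → ENNReal) (R₀ : ℝ) (i : Fin N) (χ : UnitAddTorus (Fin N × Fin 3) → ℝ), 0 < L → Measurable v → (∀ r, R₀ < r → v r = 0) → (∀ t, |χ t| ≤ 1) → (∀ t, χ t ≠ 0 → ∀ j, j ≠ i → R₀ / L < Literature.Analysis.FunctionSpaces.Torus.pairDist i j t) → ∀ η F : MeasureTheory.Lp ℂ 2 (MeasureTheory.Measure.pi fun _ : Fin N × Fin 3 => (AddCircle.haarAddCircle : MeasureTheory.Measure UnitAddCircle)), (∀ᵐ t ∂(MeasureTheory.Measure.pi fun _ : Fin N × Fin 3 => (AddCircle.haarAddCircle : MeasureTheory.Measure UnitAddCircle)), (F : UnitAddTorus (Fin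 N × Fin 3) → ℂ) t = ((χ t : ℝ) : ℂ) * ((η - Literature.MathematicalPhysics.QuantumManyBody.BoseGas.exciteProj N i η : MeasureTheory.Lp ℂ 2 (MeasureTheory.Measure.pi fun _ : Fin N × Fin 3 => (AddCircle.haarAddCircle : MeasureTheory.Measure UnitAddCircle))) : UnitAddTorus (Fin N × Fin 3) → ℂ) t) → Literature.MathematicalPhysics.QuantumManyBody.BoseGas.maxFormPot v L F ≤ Literature.MathematicalPhysics.QuantumManyBody.BoseGas.maxFormPot v L η := by
  intro N L v R₀ i χ hL hv hv0 hχb hχfree η F hF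
  exact maxFormPot_le_of_coeFn_eq_mul_sub_exciteProj hL hv hv0 hχb hχfree η hF

end Summit.AtomisticToContinuum.BoseEinsteinCondensation.Cruxes.RewardChordBound.Birth

end
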